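import Summits.NavierStokesRegularity.NavierStokesRegularity.Theorems.HardyPointSinkHardyEnergyBoundLocalHardyIdentitySlice
import Literature.Analysis.FluidPDE.ClassicalLocalEnergyCutoff
import HarnessLib

/-!
# Route HardyPointSink — `HardyEnergyBound`: the localised point-sink identity

Theorems file for the crux item stmt-NavierStokesRegularity-7979 (`HardyEnergyBound`), stub
`stub_localHardyIdentity` of the line `birth`. **The local energy identity of a classical
Navier–Stokes solution tested against `φ(x)/|x - x₀|`.** For a classical solution `(v, p)` of the
unforced Navier–Stokes system with viscosity `ν` on an OPEN time set `S`, a smooth compactly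
supported `φ`, a centre `x₀` and `[t₁, t₂] ⊆ S` (`r = |x - x₀|`):

`∫ φ|v(t₂)|²/r − ∫ φ|v(t₁)|²/r + 2ν ∫_{t₁}^{t₂}∫ φ|∇v|²/r + 4πν φ(x₀) ∫_{t₁}^{t₂} |v(s,x₀)|² ds
   = ∫_{t₁}^{t₂}∫ ( ν|v|²(Δφ/r − 2Dφ(x−x₀)/r³) + (|v|² + 2p)Dφ(v)/r − 2φ(|v|²/2 + p)⟨v, x−x₀⟩/r³ )`.

## Proof

Test the local energy identity on the open time set
(`IsClassicalNSSolutionOn.local_energy_identity_cutoff`) against the smooth compactly supported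
weights `ψₙ(x) = (‖x - x₀‖² + aₙ)^{-1/2} φ(x)`, `aₙ = (n+1)⁻²`, and let `n → ∞` at each time
slice (`…LocalHardyIdentitySlice`, `…LocalHardyIdentityLimits`): the Laplacian of the
regularised Newtonian weight is minus an approximate identity of mass `4π`, which produces the
point sink `4πν φ(x₀)|v(s, x₀)|²`; the other terms converge by dominated convergence (all data
vanish off the compact `tsupport φ`, on which `v`, `∇v`, `p` are bounded uniformly in
`s ∈ [t₁, t₂]` by joint continuity), with bounds uniform in the slice, so dominated convergence
in time and in the two boundary terms gives the identity; the limits in time are interval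
integrable as bounded pointwise limits of continuous functions.

## References

* L. Caffarelli, R. Kohn, L. Nirenberg, CPAM 35 (1982), §2 (local energy identity);
  D. Gilbarg, N. Trudinger, (2.12) (`Δ(1/r) = -4πδ` in `ℝ³`); G. Seregin, *Lecture notes on
  regularity theory for the Navier–Stokes equations* (2014), p. 113.
-/

noncomputable section

open MeasureTheory Metric Set Filter Topology TopologicalSpace Function InnerProductSpace
open Literature.Analysis.PDE Literature.Analysis.FluidPDE
open scoped RealInnerProductSpace Laplacian NNReal Interval ContDiff

set_option linter.dupNamespace false -- nested layout Summit.<S>.<Sub>, Sub = S (D-0017)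

namespace Summit.NavierStokesRegularity.NavierStokesRegularity.Theorems

/-! ### The stub -/

/-- **`stub_localHardyIdentity`** (crux item stmt-NavierStokesRegularity-7979, line `birth`):
the local energy identity of a classical solution of the unforced Navier–Stokes system on an open
time set `S`, tested against the singular weight `φ(x)/|x - x₀|` (`φ ∈ C_c^∞`), between two
times `t₁ ≤ t₂` with `[t₁, t₂] ⊆ S`; the Laplacian of `1/|x - x₀|` produces the point sink
`4πν φ(x₀) ∫_{t₁}^{t₂} |v(s, x₀)|² ds`. See the module docstring for the proof. -/
theorem stub_localHardyIdentity :
    ∀ (S : Set ℝ) (ν : ℝ) (v : ℝ → EuclideanSpace ℝ (Fin 3) → EuclideanSpace ℝ (Fin 3))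
      (p : ℝ → EuclideanSpace ℝ (Fin 3) → ℝ), IsOpen S →
      Literature.Analysis.FluidPDE.IsClassicalNSSolutionOn S ν 0 v p →
      ∀ (φ : EuclideanSpace ℝ (Fin 3) → ℝ), ContDiff ℝ (⊤ : ℕ∞) φ → HasCompactSupport φ →
      ∀ (x₀ : EuclideanSpace ℝ (Fin 3)) (t₁ t₂ : ℝ), t₁ ≤ t₂ → Set.Icc t₁ t₂ ⊆ S →
      (∫ x, φ x * ‖v t₂ x‖ ^ 2 / ‖x - x₀‖) - (∫ x, φ x * ‖v t₁ x‖ ^ 2 / ‖x - x₀‖)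
          + 2 * ν * (∫ s in t₁..t₂, ∫ x,
              φ x * Literature.Analysis.FluidPDE.frobeniusNormSq (fderiv ℝ (v s) x) / ‖x - x₀‖)
          + 4 * Real.pi * ν * φ x₀ * (∫ s in t₁..t₂, ‖v s x₀‖ ^ 2)
        = ∫ s in t₁..t₂, ∫ x,
            (ν * ‖v s x‖ ^ 2 * (Laplacian.laplacian φ x / ‖x - x₀‖
                - 2 * fderiv ℝ φ x (x - x₀) / ‖x - x₀‖ ^ 3)
              + (‖v s x‖ ^ 2 + 2 * p s x) * fderiv ℝ φ x (v s x) / ‖x - x₀‖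
              - 2 * φ x * (‖v s x‖ ^ 2 / 2 + p s x) * inner ℝ (v s x) (x - x₀) / ‖x - x₀‖ ^ 3) := by
  intro S ν u p hS hsol φ hφ hφc x₀ t₁ t₂ h12 hI
  -- smoothness and support of `φ`
  have hφ2 : ContDiff ℝ 2 φ := hφ.of_le (by norm_cast)
  have hφ1 : ContDiff ℝ 1 φ := hφ.of_le (by norm_cast)
  have hφcont : Continuous φ := hφ.continuous
  obtain ⟨R, hR0, hR⟩ : ∃ R : ℝ, 0 < R ∧ tsupport φ ⊆ closedBall (0 : EuclideanSpace ℝ (Fin 3)) R :=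
    hφc.isCompact.isBounded.subset_closedBall_lt 0 0
  -- bounds on `φ`, `Dφ`, `Δφ`
  obtain ⟨Cφ, hCφ⟩ := hφc.exists_bound_of_continuous hφcont
  obtain ⟨CD, hCD⟩ := (hφc.fderiv ℝ).exists_bound_of_continuous (hφ1.continuous_fderiv one_ne_zero)
  have hΔs : HasCompactSupport (Δ φ) := hφc.mono' fun x hx => by
    by_contra h
    exact hx (Literature.Analysis.FluidPDE.laplacian_eq_zero_of_notMem_tsupport h)
  obtain ⟨CL, hCL⟩ := hΔs.exists_bound_of_continuous
    (Literature.Analysis.FluidPDE.continuous_laplacian hφ2)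
  -- bounds on `u`, `∇u`, `p` on the compact `[t₁, t₂] × tsupport φ`
  have hK : IsCompact (Icc t₁ t₂ ×ˢ tsupport φ) := isCompact_Icc.prod hφc.isCompact
  have hKS : Icc t₁ t₂ ×ˢ tsupport φ ⊆ S ×ˢ (univ : Set (EuclideanSpace ℝ (Fin 3))) :=
    prod_mono hI (subset_univ _)
  obtain ⟨Cu, hCu⟩ := hK.exists_bound_of_continuousOn
    (hsol.smooth_velocity.continuousOn.mono hKS)
  obtain ⟨Cp, hCp⟩ := hK.exists_bound_of_continuousOn
    (hsol.smooth_pressure.continuousOn.mono hKS)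
  have hu1 : ContDiffOn ℝ 1 (uncurry u) (S ×ˢ univ) := hsol.smooth_velocity.of_le (by norm_cast)
  obtain ⟨CDu, hCDu⟩ := hK.exists_bound_of_continuousOn
    ((continuousOn_fderiv_slice_of_contDiffOn hu1 hS.uniqueDiffOn).mono hKS)
  -- one constant for all the data
  set C : ℝ := |Cφ| + |CD| + |CL| + |Cu| + |Cp| + |CDu| with hCdef
  have aφ := abs_nonneg Cφ
  have aD := abs_nonneg CD
  have aL := abs_nonneg CL
  have au := abs_nonneg Cu
  have ap := abs_nonneg Cp
  have aDu := abs_nonneg CDu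
  have hC : 0 ≤ C := by positivity
  have hφC : ∀ x, |φ x| ≤ C := fun x => by
    have h := hCφ x
    rw [Real.norm_eq_abs] at h
    linarith [le_abs_self Cφ]
  have hDφC : ∀ x, ‖fderiv ℝ φ x‖ ≤ C := fun x => by
    linarith [hCD x, le_abs_self CD]
  have hΔφC : ∀ x, |(Δ φ) x| ≤ C := fun x => by
    have h := hCL x
    rw [Real.norm_eq_abs] at h
    linarith [le_abs_self CL]
  have huC : ∀ s ∈ Icc t₁ t₂, ∀ x ∈ tsupport φ, ‖u s x‖ ≤ C := fun s hs x hx => by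
    have h : ‖u s x‖ ≤ Cu := hCu (s, x) (mk_mem_prod hs hx)
    linarith [le_abs_self Cu]
  have hpC : ∀ s ∈ Icc t₁ t₂, ∀ x ∈ tsupport φ, |p s x| ≤ C := fun s hs x hx => by
    have h : ‖p s x‖ ≤ Cp := hCp (s, x) (mk_mem_prod hs hx)
    rw [Real.norm_eq_abs] at h
    linarith [le_abs_self Cp]
  have hDuC : ∀ s ∈ Icc t₁ t₂, ∀ x ∈ tsupport φ, ‖fderiv ℝ (u s) x‖ ≤ C := fun s hs x hx => by
    have h : ‖fderiv ℝ (u s) x‖ ≤ CDu := hCDu (s, x) (mk_mem_prod hs hx)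
    linarith [le_abs_self CDu]
  -- the weights
  set ψ : ℕ → EuclideanSpace ℝ (Fin 3) → ℝ := fun n y =>
    Newtonian.regKernel ((((n : ℝ) + 1)⁻¹) ^ 2) (y - x₀) * φ y with hψdef
  have hψ : ∀ n : ℕ, ψ n = fun y =>
      Newtonian.regKernel ((((n : ℝ) + 1)⁻¹) ^ 2) (y - x₀) * φ y := fun n => rfl
  have hψs : ∀ n, ContDiff ℝ ∞ (ψ n) := fun n =>
    (hardyPointSink_contDiff_weight (hardyPointSink_seq_pos n) x₀).mul hφ
  have hψc : ∀ n, HasCompactSupport (ψ n) := fun n => hφc.mul_left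
  have hψcont : ∀ n, Continuous (ψ n) := fun n => (hψs n).continuous
  have hI' : uIcc t₁ t₂ ⊆ S := by rwa [uIcc_of_le h12]
  have hIoc : Ι t₁ t₂ ⊆ Icc t₁ t₂ := by
    rw [uIoc_of_le h12]; exact Ioc_subset_Icc_self
  have cF := fun n : ℕ => hsol.continuousOn_integral_flux_cutoff (hψs n) (hψc n)
  have cG := fun n : ℕ => hsol.continuousOn_integral_dissipation_cutoff hS (hψcont n) (hψc n)
  -- the local energy identity against `ψ n`, integrated over `[t₁, t₂]`
  have hEq : ∀ n : ℕ, (∫ x, ψ n x * ‖u t₂ x‖ ^ 2) - (∫ x, ψ n x * ‖u t₁ x‖ ^ 2) =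
      ∫ s in t₁..t₂, ((∫ x, (ν * ((Δ (ψ n)) x * ‖u s x‖ ^ 2) +
        fderiv ℝ (ψ n) x (u s x) * ‖u s x‖ ^ 2 + 2 * (p s x * fderiv ℝ (ψ n) x (u s x)))) -
        2 * ν * ∫ x, frobeniusNormSq (fderiv ℝ (u s) x) * ψ n x) := by
    intro n
    have hLEI := hsol.local_energy_identity_cutoff hS (hψs n) (hψc n) h12 hI
    have iF := ((cF n).mono hI').intervalIntegrable (μ := volume)
    have iG := ((cG n).mono hI').intervalIntegrable (μ := volume)
    rw [intervalIntegral.integral_sub iF (iG.const_mul _), intervalIntegral.integral_const_mul]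
    linarith
  -- the slice limits at every time of `[t₁, t₂]`
  have hslice := fun s (hs : s ∈ Icc t₁ t₂) =>
    hardyEnergyBound_localHardyIdentity_slice_flux x₀ ν hC hR0.le hφ2 hφc hR hφC hDφC hΔφC
      ((hsol.contDiff_velocity (hI hs)).of_le (by norm_cast))
      (hsol.contDiff_pressure (hI hs)).continuous (huC s hs) (hDuC s hs) (hpC s hs) hψ
  -- dominated convergence in time
  set M : ℝ := |ν| * (C * C ^ 2 * (1 + R) ^ 4 *
          ∫ x : EuclideanSpace ℝ (Fin 3), ((1 + ‖x‖) ^ 4)⁻¹ * ‖x - x₀‖⁻¹) +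
      2 * |ν| * (C * C ^ 2 * (1 + R) ^ 2 *
          ∫ x : EuclideanSpace ℝ (Fin 3), ((1 + ‖x‖) ^ 2)⁻¹ * (‖x - x₀‖ ^ 2)⁻¹) +
      |ν| * (4 * Real.pi * (C * C ^ 2)) +
      C * C * (C ^ 2 + 2 * C) * (1 + R) ^ 4 *
          (∫ x : EuclideanSpace ℝ (Fin 3), ((1 + ‖x‖) ^ 4)⁻¹ * ‖x - x₀‖⁻¹) +
      C * C * (C ^ 2 + 2 * C) * (1 + R) ^ 2 *
          (∫ x : EuclideanSpace ℝ (Fin 3), ((1 + ‖x‖) ^ 2)⁻¹ * (‖x - x₀‖ ^ 2)⁻¹) +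
      2 * |ν| * (C * (3 * C ^ 2) * (1 + R) ^ 4 *
          ∫ x : EuclideanSpace ℝ (Fin 3), ((1 + ‖x‖) ^ 4)⁻¹ * ‖x - x₀‖⁻¹) with hM
  have hcontΦ : ∀ n : ℕ, ContinuousOn (fun s => (∫ x, (ν * ((Δ (ψ n)) x * ‖u s x‖ ^ 2) +
        fderiv ℝ (ψ n) x (u s x) * ‖u s x‖ ^ 2 + 2 * (p s x * fderiv ℝ (ψ n) x (u s x)))) -
        2 * ν * ∫ x, frobeniusNormSq (fderiv ℝ (u s) x) * ψ n x) S := fun n =>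
    (cF n).sub (continuousOn_const.mul (cG n))
  have hbndΦ : ∀ n : ℕ, ∀ s ∈ Ι t₁ t₂, |(∫ x, (ν * ((Δ (ψ n)) x * ‖u s x‖ ^ 2) +
        fderiv ℝ (ψ n) x (u s x) * ‖u s x‖ ^ 2 + 2 * (p s x * fderiv ℝ (ψ n) x (u s x)))) -
        2 * ν * ∫ x, frobeniusNormSq (fderiv ℝ (u s) x) * ψ n x| ≤ M := fun n s hs =>
    (hslice s (hIoc hs)).2.1 n
  have hlimΦ : ∀ s ∈ Ι t₁ t₂, Tendsto (fun n : ℕ => (∫ x, (ν * ((Δ (ψ n)) x * ‖u s x‖ ^ 2) +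
        fderiv ℝ (ψ n) x (u s x) * ‖u s x‖ ^ 2 + 2 * (p s x * fderiv ℝ (ψ n) x (u s x)))) -
        2 * ν * ∫ x, frobeniusNormSq (fderiv ℝ (u s) x) * ψ n x) atTop
      (𝓝 ((∫ x, (ν * ‖u s x‖ ^ 2 * ((Δ φ) x / ‖x - x₀‖ -
          2 * fderiv ℝ φ x (x - x₀) / ‖x - x₀‖ ^ 3)
          + (‖u s x‖ ^ 2 + 2 * p s x) * fderiv ℝ φ x (u s x) / ‖x - x₀‖
          - 2 * φ x * (‖u s x‖ ^ 2 / 2 + p s x) * ⟪u s x, x - x₀⟫ / ‖x - x₀‖ ^ 3))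
        - 4 * Real.pi * ν * φ x₀ * ‖u s x₀‖ ^ 2
        - 2 * ν * ∫ x, φ x * frobeniusNormSq (fderiv ℝ (u s) x) / ‖x - x₀‖)) := fun s hs =>
    (hslice s (hIoc hs)).1
  have hRHS : Tendsto (fun n : ℕ => ∫ s in t₁..t₂, ((∫ x, (ν * ((Δ (ψ n)) x * ‖u s x‖ ^ 2) +
        fderiv ℝ (ψ n) x (u s x) * ‖u s x‖ ^ 2 + 2 * (p s x * fderiv ℝ (ψ n) x (u s x)))) -
        2 * ν * ∫ x, frobeniusNormSq (fderiv ℝ (u s) x) * ψ n x)) atTop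
      (𝓝 (∫ s in t₁..t₂, ((∫ x, (ν * ‖u s x‖ ^ 2 * ((Δ φ) x / ‖x - x₀‖ -
          2 * fderiv ℝ φ x (x - x₀) / ‖x - x₀‖ ^ 3)
          + (‖u s x‖ ^ 2 + 2 * p s x) * fderiv ℝ φ x (u s x) / ‖x - x₀‖
          - 2 * φ x * (‖u s x‖ ^ 2 / 2 + p s x) * ⟪u s x, x - x₀⟫ / ‖x - x₀‖ ^ 3))
        - 4 * Real.pi * ν * φ x₀ * ‖u s x₀‖ ^ 2
        - 2 * ν * ∫ x, φ x * frobeniusNormSq (fderiv ℝ (u s) x) / ‖x - x₀‖))) := by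
    refine intervalIntegral.tendsto_integral_filter_of_dominated_convergence (fun _ => M) ?_ ?_
      intervalIntegrable_const (Eventually.of_forall hlimΦ)
    · exact Eventually.of_forall fun n =>
        ((hcontΦ n).mono (hIoc.trans hI)).aestronglyMeasurable measurableSet_uIoc
    · refine Eventually.of_forall fun n => Eventually.of_forall fun s hs => ?_
      rw [Real.norm_eq_abs]
      exact hbndΦ n s hs
  -- the boundary terms
  have hLHS : ∀ t ∈ Icc t₁ t₂, Tendsto (fun n : ℕ => ∫ x, ψ n x * ‖u t x‖ ^ 2) atTop
      (𝓝 (∫ x, φ x * ‖u t x‖ ^ 2 / ‖x - x₀‖)) := by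
    intro t ht
    have key := hardyEnergyBound_localHardyIdentity_slice_energy x₀ hC hR0.le hφcont hR hφC
      (hsol.contDiff_velocity (hI ht)).continuous (huC t ht)
    refine key.congr fun n => integral_congr_ae (Eventually.of_forall fun x => ?_)
    simp only [hψ n]
  have hLHS' : Tendsto (fun n : ℕ => (∫ x, ψ n x * ‖u t₂ x‖ ^ 2) - (∫ x, ψ n x * ‖u t₁ x‖ ^ 2))
      atTop (𝓝 ((∫ x, φ x * ‖u t₂ x‖ ^ 2 / ‖x - x₀‖) - (∫ x, φ x * ‖u t₁ x‖ ^ 2 / ‖x - x₀‖))) :=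
    (hLHS t₂ ⟨h12, le_rfl⟩).sub (hLHS t₁ ⟨le_rfl, h12⟩)
  have hfin := tendsto_nhds_unique hLHS' (hRHS.congr fun n => (hEq n).symm)
  -- interval integrability of the limits
  have iR := hardyEnergyBound_localHardyIdentity_intervalIntegrable_of_tendsto (hIoc.trans hI)
    hcontΦ hbndΦ hlimΦ
  have hbndD : ∀ n : ℕ, ∀ s ∈ Ι t₁ t₂,
      |∫ x, frobeniusNormSq (fderiv ℝ (u s) x) * ψ n x| ≤ C * (3 * C ^ 2) * (1 + R) ^ 4 *
        ∫ x : EuclideanSpace ℝ (Fin 3), ((1 + ‖x‖) ^ 4)⁻¹ * ‖x - x₀‖⁻¹ := fun n s hs =>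
    (hslice s (hIoc hs)).2.2.2 n
  have hlimD : ∀ s ∈ Ι t₁ t₂,
      Tendsto (fun n : ℕ => ∫ x, frobeniusNormSq (fderiv ℝ (u s) x) * ψ n x) atTop
        (𝓝 (∫ x, φ x * frobeniusNormSq (fderiv ℝ (u s) x) / ‖x - x₀‖)) := fun s hs =>
    (hslice s (hIoc hs)).2.2.1
  have iD := hardyEnergyBound_localHardyIdentity_intervalIntegrable_of_tendsto (hIoc.trans hI)
    cG hbndD hlimD
  have ig : IntervalIntegrable (fun s => ‖u s x₀‖ ^ 2) volume t₁ t₂ := by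
    have h1 : ContinuousOn (fun s : ℝ => ((s, x₀) : ℝ × EuclideanSpace ℝ (Fin 3))) S :=
      (continuous_id.prodMk continuous_const).continuousOn
    have h2 : ContinuousOn (fun s => u s x₀) S :=
      hsol.smooth_velocity.continuousOn.comp h1 fun s hs => mk_mem_prod hs (mem_univ _)
    exact ((h2.norm.pow 2).mono hI').intervalIntegrable
  have imain : IntervalIntegrable (fun s => ∫ x, (ν * ‖u s x‖ ^ 2 * ((Δ φ) x / ‖x - x₀‖ -
          2 * fderiv ℝ φ x (x - x₀) / ‖x - x₀‖ ^ 3)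
          + (‖u s x‖ ^ 2 + 2 * p s x) * fderiv ℝ φ x (u s x) / ‖x - x₀‖
          - 2 * φ x * (‖u s x‖ ^ 2 / 2 + p s x) * ⟪u s x, x - x₀⟫ / ‖x - x₀‖ ^ 3))
      volume t₁ t₂ := by
    have h := (iR.add (iD.const_mul (2 * ν))).add (ig.const_mul (4 * Real.pi * ν * φ x₀))
    refine h.congr fun s _ => ?_
    ring
  -- conclusion
  rw [hfin, intervalIntegral.integral_sub (imain.sub (ig.const_mul _)) (iD.const_mul _),
    intervalIntegral.integral_sub imain (ig.const_mul _), intervalIntegral.integral_const_mul,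
    intervalIntegral.integral_const_mul]
  ring

end Summit.NavierStokesRegularity.NavierStokesRegularity.Theorems

end
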